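/-
Copyright (c) 2026. All rights reserved.
Released under Apache 2.0 license as described in the file LICENSE.
Authors: abc-iut cell, seat abc-iut-L4-t8 (gen 9; L4-lead row «TYPE-CHOL-THPLUS»: the category
`𝒞^hol_{TH⊞}` of [AbsTopIII] Def 4.1 (iii) and the functors `λ⊞` of Def 5.4 (vi), statements/definitions
over abc-iut-L4-t10's `ArchimedeanHolPairs` / `ArchimedeanLogFrobeniusModel`).
-/
import Literature.AnabelianGeometry.AbsoluteAnabelian.ArchimedeanLogFrobeniusModel
import Literature.AnabelianGeometry.AbsoluteAnabelian.ArchimedeanUnivCoverTopology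
import Mathlib.Topology.Algebra.ContinuousMonoidHom
import HarnessLib

/-!
# [AbsTopIII] Def 4.1 (i)–(iii) for `T = TH⊞`: the category `𝒞^hol_{TH⊞}` of Aut-holomorphic `TH⊞`-pairs, and the functors `λ⊞` of Def 5.4 (vi)

S. Mochizuki, *Topics in absolute anabelian geometry III*, kurims manuscript (`paper:url-5493eb38cbb7`,
read on the page; bib key `MochizukiAbsTopIII2015`): Def 4.1 (i) p.101–102 («`TH⊞` for the category of
connected Aut-holomorphic groups [i.e., Aut-holomorphic spaces equipped with a topological group
structure such that both the Aut-holomorphic and topological group structures arise from a single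
connected complex Lie group structure] and homomorphisms of Aut-holomorphic groups»; for `T = TH⊞` the
model arithmetic datum is «any object of `TH⊞` equipped with an Aut-holomorphic homomorphism
`κ_{M_k} : M_k → A_{X_ell} (⊆ 𝒜_{X_ell})` [relative to the multiplicative structure of `𝒜_{X_ell}`]»),
Def 4.1 (ii)(iii) pp.102–103 (Aut-holomorphic `T`-pairs, their morphisms, the category `𝒞^hol_T`),
Def 5.4 (v) p.127 («the diagram `Γ⃗⋉_arc` may be considered either as a diagram in the category `TH` or
as a diagram in `TH⊞`») and Def 5.4 (vi) p.128 («we have natural functors `𝒞^hol_{TH⊞} → 𝒞^hol_TH → EA`»;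
«by assigning to "`k`" … the object at the vertex `ν` of the diagram of (v), we obtain a natural functor
`𝒞^hol_T → 𝒞^hol_{TH⊞}`», the `λ⊞_{v,ν}`).

## What is typed (statements-first, cell row «TYPE-CHOL-THPLUS», L4-lead m128)

MODELLING (the convention of abc-iut-L4-t10's `HolTHPair` = `𝒞^hol_TH`: arithmetic data PRESENTED
INSIDE A CAF).  An object of `𝒞^hol_{TH⊞}` is `(𝕏 ↶^κ M)` with `M` a connected Aut-holomorphic GROUP and
`κ` an Aut-holomorphic HOMOMORPHISM into `𝒜_𝕏^×`; isomorphic (Def 4.1 (ii) (c)) to a model pair.  The two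
connected Aut-holomorphic groups that §4–§5 use are those of Def 4.1 (iv) / 5.4 (v): `k^×`
(multiplicative) and `k∼` (the universal covering of `k^×`, realised in the tree as the ADDITIVE group
`(k, +)` with covering map `exp_k = univCover k`).  We type exactly these two SHAPES (`THPlusShape`):

* `HolTHPlusPair 𝔄` — an object: structure-orbispace `𝕏 ∈ Ob(EA)`, a CAF `k` with a bicontinuous field
  isomorphism `c : k ⥲ 𝒜_𝕏` (the `k`-Kummer structure of the model), a shape, and the Aut-holomorphic
  group as an ABSTRACT topological abelian group `B` PRESENTED inside `k` by a homeomorphism `pres` onto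
  `k ∖ {0}` (shape `times`, group law = multiplication) resp. onto `k` (shape `sim`, group law =
  addition); the KUMMER HOMOMORPHISM `κ : B → 𝒜_𝕏^×` is then `c ∘ pres` resp. `c ∘ exp_k ∘ pres`
  (`HolTHPlusPair.κ`, a continuous homomorphism into the multiplicative group: `κ_add`, `κ_ne_zero`,
  `continuous_κ`);
  -- TODO(general form): arbitrary connected Aut-holomorphic groups as arithmetic data of type `TH⊞`
  -- (Def 4.1 (i)); the only further connected Aut-holomorphic groups admitting a Kummer homomorphism
  -- are `(ℂ^×, z ↦ zⁿ)`, `|n| ≥ 2`, which §4–§5 never use.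
* `HolTHPlusPair.Hom` — a morphism `(𝕏₁ ↶ M₁) → (𝕏₂ ↶ M₂)`: a finite étale `φ_𝕏 : 𝕏₁ → 𝕏₂` and a
  continuous HOMOMORPHISM `φ_M : M₁ → M₂` of the Aut-holomorphic groups, compatible with the Kummer
  homomorphisms (`κ₂ ∘ φ_M = 𝒜_{φ_𝕏} ∘ κ₁`) and a morphism of Aut-holomorphic spaces (holomorphic local
  isomorphism in the Kummer charts, as in `HolTHPair.Hom`); the category instance;
* `HolTHPlusPair.toEA`, `HolTHPlusPair.forgetTH : 𝒞^hol_{TH⊞} ⥤ 𝒞^hol_TH` (Def 5.4 (vi)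
  «`𝒞^hol_{TH⊞} → 𝒞^hol_TH → EA`»);
* sequel files: `ArchimedeanHolGroupPairsLambda` (the functors `λ⊞` of Def 5.4 (vi) lifting `λ^×`,
  `λ^∼`, and `ι⊞_×`), and the Def 5.6 (iv) `TB⊞`-leg `𝒞^hol_{TH⊞} → 𝒞^{hol⊢}_{TB⊞}`.  Refereed pre-IUT anabelian
geometry; a MODEL (kernel definitions) over the interface `AutHolFieldFunctor`; no instances beyond the
structure-carried ones and the category; nothing here bears on [IUTchIII] Cor. 3.12; typed ≠ proved.
-/

set_option autoImplicit false

noncomputable section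

namespace Literature.AnabelianGeometry.AbsoluteAnabelian

open _root_.CategoryTheory _root_.Topology

universe u

/-! ### The two shapes of connected Aut-holomorphic groups used in §4–§5 -/

/-- The two connected Aut-holomorphic GROUPS of Def 4.1 (iv) / Def 5.4 (v) presented inside a CAF `k`:
`times` = `k^×` (multiplicative group of `k`), `sim` = `k∼` (universal covering of `k^×`, realised as the
additive group `(k, +)` with covering map `exp_k`). [cite: MochizukiAbsTopIII2015, Definition 4.1 (i) p.101] -/
inductive THPlusShape : Type
  | times
  | sim

namespace THPlusShape

variable {k : Type u} [NormedField k]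

variable (k) in
/-- The underlying subset of `k`: `k ∖ {0}` for `k^×`, all of `k` for `k∼`.
[cite: MochizukiAbsTopIII2015, Definition 4.1 (iv) p.104] -/
def carrier (s : THPlusShape) : Set k :=
  match s with
  | times => {x : k | x ≠ 0}
  | sim => Set.univ

/-- The group law of the shape on `k`: multiplication for `k^×`, addition for `k∼`.
[cite: MochizukiAbsTopIII2015, Definition 4.1 (i) p.101] -/
def op (s : THPlusShape) : k → k → k :=
  match s with
  | times => fun x y => x * y
  | sim => fun x y => x + y

/-- The Kummer homomorphism of the shape through a `k`-Kummer structure `c : k ⥲ 𝒜`: `c` itself on `k^×`,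
`c ∘ exp_k` on `k∼`. [cite: MochizukiAbsTopIII2015, Definition 4.1 (i) p.102] -/
def kummer [CharZero k] {A : Type u} [NormedField A] (s : THPlusShape) (c : k ≃+* A) : k → A :=
  match s with
  | times => fun x => c x
  | sim => fun x => c (univCover k x)

/-- On `k^×` the Kummer homomorphism is `c`. [cite: MochizukiAbsTopIII2015, Definition 4.1 (i) p.102] -/
@[simp] theorem kummer_times [CharZero k] {A : Type u} [NormedField A] (c : k ≃+* A) (x : k) :
    THPlusShape.times.kummer c x = c x := rfl

/-- On `k∼` the Kummer homomorphism is `c ∘ exp_k`. [cite: MochizukiAbsTopIII2015, Definition 4.1 (i) p.102] -/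
@[simp] theorem kummer_sim [CharZero k] {A : Type u} [NormedField A] (c : k ≃+* A) (x : k) :
    THPlusShape.sim.kummer c x = c (univCover k x) := rfl

/-- The carrier of `k^×` is `k ∖ {0}`. [cite: MochizukiAbsTopIII2015, Definition 4.1 (iv) p.104] -/
@[simp] theorem carrier_times : THPlusShape.times.carrier k = {x : k | x ≠ 0} := rfl

/-- The carrier of `k∼` is `k`. [cite: MochizukiAbsTopIII2015, Definition 4.1 (iv) p.104] -/
@[simp] theorem carrier_sim : THPlusShape.sim.carrier k = Set.univ := rfl

/-- The Kummer homomorphism of either shape never vanishes on the carrier.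
[cite: MochizukiAbsTopIII2015, Definition 4.1 (i) p.102] -/
theorem kummer_ne_zero [CharZero k] {A : Type u} [NormedField A] (hk : IsCAF k) (s : THPlusShape)
    (c : k ≃+* A) {x : k} (hx : x ∈ s.carrier k) : s.kummer c x ≠ 0 := by
  cases s
  · exact (map_ne_zero_iff c c.injective).mpr hx
  · exact (map_ne_zero_iff c c.injective).mpr (IsCAF.univCover_ne_zero hk x)

/-- The Kummer homomorphism of either shape turns the shape's law into multiplication.
[cite: MochizukiAbsTopIII2015, Definition 4.1 (i) p.102] -/
theorem kummer_op [CharZero k] {A : Type u} [NormedField A] (hk : IsCAF k) (s : THPlusShape)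
    (c : k ≃+* A) (x y : k) : s.kummer c (s.op x y) = s.kummer c x * s.kummer c y := by
  cases s
  · exact map_mul c x y
  · change c (univCover k (x + y)) = c (univCover k x) * c (univCover k y)
    rw [IsCAF.univCover_add hk, map_mul]

/-- The Kummer homomorphism of either shape is continuous (for a continuous chart).
[cite: MochizukiAbsTopIII2015, Definition 4.1 (i) p.102] -/
theorem continuous_kummer [CharZero k] {A : Type u} [NormedField A] (hk : IsCAF k) (s : THPlusShape)
    {c : k ≃+* A} (hc : Continuous c) : Continuous (s.kummer c) := by
  cases s
  · exact hc
  · exact hc.comp (IsCAF.continuous_univCover hk)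

/-- The carriers are open. [cite: MochizukiAbsTopIII2015, Definition 4.1 (i) p.101] -/
theorem isOpen_carrier (s : THPlusShape) : IsOpen (s.carrier k) := by
  cases s
  · exact isOpen_ne
  · exact isOpen_univ

/-- The carriers are connected («connected Aut-holomorphic groups»). [cite: MochizukiAbsTopIII2015, Definition 4.1 (i) p.101] -/
theorem isConnected_carrier (hk : IsCAF k) (s : THPlusShape) : IsConnected (s.carrier k) := by
  cases s
  · exact hk.isConnected_ne_zero
  · exact hk.isConnected_univ

end THPlusShape

/-! ### Objects of `𝒞^hol_{TH⊞}` -/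

/-- **An object of `𝒞^hol_{TH⊞}`** (Def 4.1 (ii)(iii) for `T = TH⊞`) with arithmetic data presented inside a
CAF: structure-orbispace `𝕏 ∈ Ob(EA)`; a CAF `k` with a bicontinuous `k`-Kummer structure `c : k ⥲ 𝒜_𝕏`;
a SHAPE; and the arithmetic datum — «an object of `TH⊞`», a connected Aut-holomorphic group — as an
abstract topological abelian group `B` PRESENTED inside `k` by a homeomorphism `pres` onto the shape's
carrier, the group law being the shape's law (`pres_add`).  Its Kummer structure is the homomorphism
`HolTHPlusPair.κ`. [cite: MochizukiAbsTopIII2015, Definition 4.1 (ii) p.102] -/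
structure HolTHPlusPair (𝔄 : AutHolFieldFunctor.{u}) : Type (u + 1) where
  /-- The structure-orbispace `𝕏`. -/
  X : 𝔄.EA
  /-- The ambient CAF. -/
  k : Type u
  [normedField : NormedField k]
  isCAF : IsCAF k
  /-- The `k`-Kummer structure of the model pair. -/
  c : k ≃+* 𝔄.A X
  continuous_c : Continuous c
  continuous_c_symm : Continuous c.symm
  /-- Which connected Aut-holomorphic group: `k^×` or `k∼`. -/
  shape : THPlusShape
  /-- The Aut-holomorphic group, as a topological abelian group (written additively). -/
  B : Type u
  [addCommGroup : AddCommGroup B]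
  [top : TopologicalSpace B]
  [topGrp : IsTopologicalAddGroup B]
  /-- Its presentation inside `k`. -/
  pres : B ≃ₜ shape.carrier k
  /-- The group law is the shape's law. -/
  pres_add : ∀ a b : B, ((pres (a + b) : shape.carrier k) : k) = shape.op (pres a : k) (pres b : k)

attribute [instance] HolTHPlusPair.normedField HolTHPlusPair.addCommGroup HolTHPlusPair.top
  HolTHPlusPair.topGrp

namespace HolTHPlusPair

variable {𝔄 : AutHolFieldFunctor.{u}}

/-- The ambient CAF has characteristic zero. [cite: MochizukiAbsTopIII2015, Definition 4.1 (i) p.101] -/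
theorem charZero_k (P : HolTHPlusPair 𝔄) : CharZero P.k := P.isCAF.charZero

/-- The underlying `TH`-pair `(𝕏 ↶ M)` (forget the group structure): the same structure-orbispace, CAF,
Kummer chart and carrier. [cite: MochizukiAbsTopIII2015, Definition 5.4 (vi) p.128] -/
def toTHPair (P : HolTHPlusPair 𝔄) : HolTHPair 𝔄 where
  X := P.X
  k := P.k
  isCAF := P.isCAF
  carrier := P.shape.carrier P.k
  isOpen_carrier := P.shape.isOpen_carrier
  isConnected_carrier := P.shape.isConnected_carrier P.isCAF
  c := P.c
  continuous_c := P.continuous_c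
  continuous_c_symm := P.continuous_c_symm

/-- **The Kummer structure** of a `TH⊞`-pair: the Aut-holomorphic homomorphism `κ : M → 𝒜_𝕏^×`
(«relative to the multiplicative structure of `𝒜_𝕏`»): `c` on `k^×`, `c ∘ exp_k` on `k∼`.
[cite: MochizukiAbsTopIII2015, Definition 4.1 (i) p.102] -/
def κ (P : HolTHPlusPair 𝔄) (b : P.B) : 𝔄.A P.X :=
  haveI := P.charZero_k
  P.shape.kummer P.c (P.pres b : P.k)

/-- Unfolding the Kummer structure. [cite: MochizukiAbsTopIII2015, Definition 4.1 (i) p.102] -/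
theorem κ_def (P : HolTHPlusPair 𝔄) (b : P.B) :
    P.κ b = @THPlusShape.kummer P.k _ P.charZero_k _ _ P.shape P.c (P.pres b : P.k) := rfl

/-- The Kummer structure takes values in `𝒜_𝕏^×`. [cite: MochizukiAbsTopIII2015, Definition 4.1 (i) p.102] -/
theorem κ_ne_zero (P : HolTHPlusPair 𝔄) (b : P.B) : P.κ b ≠ 0 :=
  @THPlusShape.kummer_ne_zero P.k _ P.charZero_k _ _ P.isCAF P.shape P.c _ (P.pres b).2

/-- **The Kummer structure is a HOMOMORPHISM** into the multiplicative group.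
[cite: MochizukiAbsTopIII2015, Definition 4.1 (i) p.102] -/
theorem κ_add (P : HolTHPlusPair 𝔄) (a b : P.B) : P.κ (a + b) = P.κ a * P.κ b := by
  rw [κ_def, κ_def, κ_def, P.pres_add]
  exact @THPlusShape.kummer_op P.k _ P.charZero_k _ _ P.isCAF P.shape P.c _ _

/-- `κ 0 = 1`. [cite: MochizukiAbsTopIII2015, Definition 4.1 (i) p.102] -/
theorem κ_zero (P : HolTHPlusPair 𝔄) : P.κ 0 = 1 := by
  have h := P.κ_add 0 0
  rw [add_zero] at h
  exact (mul_eq_left₀ (P.κ_ne_zero 0)).mp h.symm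

/-- The Kummer structure is continuous. [cite: MochizukiAbsTopIII2015, Definition 4.1 (i) p.102] -/
theorem continuous_κ (P : HolTHPlusPair 𝔄) : Continuous P.κ :=
  (@THPlusShape.continuous_kummer P.k _ P.charZero_k _ _ P.isCAF P.shape P.c P.continuous_c).comp
    (continuous_subtype_val.comp P.pres.continuous)

/-! ### Morphisms and the category `𝒞^hol_{TH⊞}` -/

/-- The map on presented arithmetic data underlying a homomorphism `φ_M : M₁ → M₂`.
[cite: MochizukiAbsTopIII2015, Definition 4.1 (ii) p.102] -/
def presMap (P Q : HolTHPlusPair 𝔄) (f : P.B → Q.B) (x : P.shape.carrier P.k) : Q.k :=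
  (Q.pres (f (P.pres.symm x)) : Q.k)

/-- `presMap` of the identity is the inclusion. [cite: MochizukiAbsTopIII2015, Definition 4.1 (ii) p.102] -/
theorem presMap_id (P : HolTHPlusPair 𝔄) (x : P.shape.carrier P.k) : presMap P P id x = (x : P.k) := by
  unfold presMap
  rw [id, Homeomorph.apply_symm_apply]

/-- `presMap` of a composite. [cite: MochizukiAbsTopIII2015, Definition 4.1 (ii) p.102] -/
theorem presMap_comp (P Q R : HolTHPlusPair 𝔄) (f : P.B → Q.B) (g : Q.B → R.B)
    (x : P.shape.carrier P.k) :
    presMap Q R g ⟨presMap P Q f x, (Q.pres (f (P.pres.symm x))).2⟩ = presMap P R (g ∘ f) x := by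
  unfold presMap
  rw [Subtype.coe_eta, Homeomorph.symm_apply_apply]
  rfl

/-- **A morphism of `𝒞^hol_{TH⊞}`** `(𝕏₁ ↶ M₁) → (𝕏₂ ↶ M₂)` (Def 4.1 (ii)): «a morphism of objects
`φ_M : M₁ → M₂` of `T`» — for `T = TH⊞` a HOMOMORPHISM of Aut-holomorphic groups: a continuous group
homomorphism (`arith`) which is a morphism of the Aut-holomorphic spaces (holomorphic local isomorphism in
the Kummer charts, `hol`, as in `HolTHPair.Hom`; onto, `surj` — automatic in print, recorded) — «together
with a compatible [relative to the
respective Kummer structures] finite étale morphism `φ_𝕏 : 𝕏₁ → 𝕏₂`» (`base`, `compat`).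
[cite: MochizukiAbsTopIII2015, Definition 4.1 (ii) p.102] -/
@[ext]
structure Hom (P Q : HolTHPlusPair 𝔄) : Type (u + 1) where
  /-- `φ_𝕏`, a finite étale morphism of `EA`. -/
  base : P.X ⟶ Q.X
  /-- `φ_M`, a continuous homomorphism of the Aut-holomorphic groups. -/
  arith : P.B →ₜ+ Q.B
  /-- `φ_M` is onto (AUTOMATIC in print: a homomorphism of connected Aut-holomorphic groups that is a
  morphism of Aut-holomorphic spaces is an open map, hence onto; RECORDED here because morphisms of
  `TB⊞` (Def 5.6 (i)) are SURJECTIVE homomorphisms). -/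
  surj : Function.Surjective arith
  /-- Compatibility with the Kummer homomorphisms: `κ₂ ∘ φ_M = 𝒜_{φ_𝕏} ∘ κ₁`. -/
  compat : ∀ b : P.B, Q.κ (arith b) = 𝔄.Amap base (P.κ b)
  /-- `φ_M` is a morphism of Aut-holomorphic spaces: holomorphic local isomorphism in the charts. -/
  hol : ∀ (e : 𝔄.A Q.X ≃+* ℂ), Continuous e → Continuous e.symm →
    IsHolLocIso (P.toTHPair.chart base e) (Q.toTHPair.chart (𝟙 Q.X) e) (P.shape.carrier P.k)
      (presMap P Q arith)

/-- The underlying morphism of `𝒞^hol_TH`. [cite: MochizukiAbsTopIII2015, Definition 5.4 (vi) p.128] -/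
def Hom.toTH {P Q : HolTHPlusPair 𝔄} (φ : Hom P Q) : P.toTHPair ⟶ Q.toTHPair where
  base := φ.base
  toFun := presMap P Q φ.arith
  mem _ := (Q.pres _).2
  hol := φ.hol

/-- The identity morphism. [cite: MochizukiAbsTopIII2015, Definition 4.1 (ii) p.102] -/
protected def Hom.id (P : HolTHPlusPair 𝔄) : Hom P P where
  base := 𝟙 P.X
  arith := ContinuousAddMonoidHom.id P.B
  surj := Function.surjective_id
  compat b := by rw [𝔄.Amap_id_apply]; rfl
  hol e he he' :=
    IsHolLocIso.of_eq_id (P.toTHPair.chart_injective _ e) (P.toTHPair.isOpen_chart_image _ e he he')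
      (fun x => by
        change e (𝔄.Amap (𝟙 P.X) (P.c (P.pres (P.pres.symm x) : P.k))) = e (𝔄.Amap (𝟙 P.X) (P.c x.1))
        rw [Homeomorph.apply_symm_apply])

/-- Composition of morphisms. [cite: MochizukiAbsTopIII2015, Definition 4.1 (ii) p.102] -/
protected def Hom.comp {P Q R : HolTHPlusPair 𝔄} (φ : Hom P Q) (ψ : Hom Q R) : Hom P R where
  base := φ.base ≫ ψ.base
  arith := ψ.arith.comp φ.arith
  surj := ψ.surj.comp φ.surj
  compat b := by
    change R.κ (ψ.arith (φ.arith b)) = _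
    rw [𝔄.Amap_comp_apply, ψ.compat, φ.compat]
  hol e he he' := by
    have h := (φ.toTH ≫ ψ.toTH).hol e he he'
    have hfun : (φ.toTH ≫ ψ.toTH).toFun = presMap P R (ψ.arith.comp φ.arith) := by
      funext x
      exact presMap_comp P Q R φ.arith ψ.arith x
    rw [hfun] at h
    exact h

/-- **`𝒞^hol_{TH⊞}` is a category** (Def 4.1 (iii): «the category whose objects are the Aut-holomorphic
`T`-pairs and whose morphisms are the morphisms of Aut-holomorphic `T`-pairs», `T = TH⊞`).
[cite: MochizukiAbsTopIII2015, Definition 4.1 (iii) pp.102–103] -/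
instance category : Category.{u + 1} (HolTHPlusPair 𝔄) where
  Hom := Hom
  id := Hom.id
  comp := Hom.comp
  id_comp φ := by
    apply Hom.ext
    · exact Category.id_comp _
    · rfl
  comp_id φ := by
    apply Hom.ext
    · exact Category.comp_id _
    · rfl
  assoc φ ψ χ := by
    apply Hom.ext
    · exact Category.assoc _ _ _
    · rfl

/-- The structure part of an identity is the identity. [cite: MochizukiAbsTopIII2015, Definition 4.1 (ii) p.102] -/
@[simp] theorem id_base (P : HolTHPlusPair 𝔄) : (𝟙 P : Hom P P).base = 𝟙 P.X := rfl
/-- The arithmetic part of an identity is the identity homomorphism. [cite: MochizukiAbsTopIII2015, Definition 4.1 (ii) p.102] -/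
@[simp] theorem id_arith_apply (P : HolTHPlusPair 𝔄) (b : P.B) : (𝟙 P : Hom P P).arith b = b := rfl
/-- The structure part of a composite is the composite. [cite: MochizukiAbsTopIII2015, Definition 4.1 (ii) p.102] -/
@[simp] theorem comp_base {P Q R : HolTHPlusPair 𝔄} (φ : P ⟶ Q) (ψ : Q ⟶ R) :
    (φ ≫ ψ).base = φ.base ≫ ψ.base := rfl
/-- The arithmetic part of a composite is the composite homomorphism. [cite: MochizukiAbsTopIII2015, Definition 4.1 (ii) p.102] -/
@[simp] theorem comp_arith_apply {P Q R : HolTHPlusPair 𝔄} (φ : P ⟶ Q) (ψ : Q ⟶ R) (b : P.B) :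
    (φ ≫ ψ).arith b = ψ.arith (φ.arith b) := rfl

variable (𝔄) in
/-- **Def 4.1 (iii) / Def 5.4 (vi): the natural functor `𝒞^hol_{TH⊞} → EA`**, `(𝕏 ↶ M) ↦ 𝕏`.
[cite: MochizukiAbsTopIII2015, Definition 5.4 (vi) p.128] -/
def toEA : HolTHPlusPair 𝔄 ⥤ 𝔄.EA where
  obj P := P.X
  map φ := φ.base

variable (𝔄) in
/-- **Def 5.4 (vi): the natural functor `𝒞^hol_{TH⊞} → 𝒞^hol_TH`** («we have natural functors
`𝒞^hol_{TH⊞} → 𝒞^hol_TH → EA`»): forget the group structure of the arithmetic datum.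
[cite: MochizukiAbsTopIII2015, Definition 5.4 (vi) p.128] -/
def forgetTH : HolTHPlusPair 𝔄 ⥤ HolTHPair 𝔄 where
  obj P := P.toTHPair
  map φ := φ.toTH
  map_id P := by
    apply HolTHPair.Hom.ext
    · rfl
    · funext x
      exact presMap_id P x
  map_comp {P Q R} φ ψ := by
    apply HolTHPair.Hom.ext
    · rfl
    · funext x
      exact (presMap_comp P Q R φ.arith ψ.arith x).symm

/-- `𝒞^hol_{TH⊞} → 𝒞^hol_TH → EA` is `𝒞^hol_{TH⊞} → EA` on the nose. [cite: MochizukiAbsTopIII2015, Definition 5.4 (vi) p.128] -/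
theorem forgetTH_toEA : forgetTH 𝔄 ⋙ HolTHPair.toEA 𝔄 = toEA 𝔄 := rfl

end HolTHPlusPair

end Literature.AnabelianGeometry.AbsoluteAnabelian

end
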